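import Summits.QuantumFields.YangMills.Theses.ToronCumulantSign
import Summits.QuantumFields.YangMills.Theorems.ToronCumulantSignOneSiteExpectations
import Summits.QuantumFields.YangMills.Theorems.ToronCumulantSignTiltDerivative

/-!
# Route `ToronCumulantSign` — the crux `OneSiteCovDerivative` (stmt-QuantumFields-27531), PROVED

★★ For every `N ≥ 2`, on the one-site (`L = 1`, Eguchi–Kawai) torus `(ℤ/1)⁴`, the complementary-plane covariance
`β ↦ Cov_β(Re tr U_(0;01), Re tr U_(0;23))` under the `SU(N)` Wilson measure is differentiable at `β = 0` with derivative
`(4/N²)·κ_N`, `κ_N = ∫∫ (|tr X|² − 1)(|tr Y|² − 1) Re tr(XYX⁻¹Y⁻¹) dX dY` (the literal double Haar integral of crux 2).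

Proof.  The Wilson measure is product Haar tilted by `−β S_W` (`wilsonMeasure_eq_tilted_pi`); the first cumulant of a Gibbs tilt
(helper `hasDerivAt_integral_tilted_zero`) gives `d/dβ|₀ Cov_β(P,Q) = Cov(PQ,X) − Cov(P,X)E Q − E P·Cov(Q,X)` with `X = −S_W =
Σ_p (Re tr U_p − N)` over the SIX plaquettes of the one-site torus, whose holonomies are commutators `U_i U_j U_i⁻¹ U_j⁻¹`
(`plaquetteHolonomy_oneSite`).  The two in-plane plaquettes contribute `0` (independence of the planes); each of the four mixed
plaquettes contributes `κ_N/N²`, by the product-Haar bookkeeping of helpers II–IV (only the Schur integral `∫ Re tr(XYX⁻¹Y⁻¹) dY =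
|tr X|²/N` enters).  HONEST LABEL: with crux 2 (`CommutatorSkewMoment`, p680606) this closes the barrier-ledger line
`ToronCumulantSign` (Griffiths II fails for `SU(N)` plaquette energies); nothing about any LADDER-YM rung or the Yang–Mills mass gap.

References: S. Chatterjee, arXiv:1803.01950 §2–3; K. Wilson, Phys. Rev. D 10 (1974) 2445 [Wilson1974]; B. Collins, P. Śniady,
CMP 264 (2006) [CollinsSniady2006].
-/

noncomputable section

open MeasureTheory ProbabilityTheory
open Literature.MathematicalPhysics.QuantumLattice Literature.MathematicalPhysics.QuantumFieldTheory
open Literature.Barriers.QuantumFields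

namespace Summit.QuantumFields.YangMills.Theorems.ToronCumulantSign

/-! ### A generic covariance expansion -/

/-- `Cov(H, −Σ_p (c − G_p)) = Σ_p Cov(H, G_p)` (constants drop out of a covariance). [folklore] -/
theorem cov_neg_sum_const_sub {Ω : Type*} [MeasurableSpace Ω] {μ : Measure Ω} [IsProbabilityMeasure μ] {ι' : Type*}
    [Fintype ι'] (H : Ω → ℝ) (G : ι' → Ω → ℝ) (c : ℝ) (hH : Integrable H μ) (hG : ∀ p, Integrable (G p) μ)
    (hHG : ∀ p, Integrable (fun ω => H ω * G p ω) μ) :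
    (∫ ω, H ω * (-(∑ p, (c - G p ω))) ∂μ) - (∫ ω, H ω ∂μ) * (∫ ω, (-(∑ p, (c - G p ω))) ∂μ) =
      ∑ p, ((∫ ω, H ω * G p ω ∂μ) - (∫ ω, H ω ∂μ) * (∫ ω, G p ω ∂μ)) := by
  have e1 : ∀ ω, H ω * (-(∑ p, (c - G p ω))) = ∑ p, (H ω * G p ω - c * H ω) := by
    intro ω
    rw [neg_eq_neg_one_mul, Finset.mul_sum, Finset.mul_sum]
    exact Finset.sum_congr rfl fun p _ => by ring
  have e2 : ∀ ω, (-(∑ p, (c - G p ω))) = ∑ p, (G p ω - c) := by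
    intro ω
    rw [neg_eq_neg_one_mul, Finset.mul_sum]
    exact Finset.sum_congr rfl fun p _ => by ring
  simp_rw [e1, e2]
  have i1 : ∀ p, Integrable (fun ω => H ω * G p ω - c * H ω) μ := fun p => (hHG p).sub (hH.const_mul c)
  have i2 : ∀ p, Integrable (fun ω => G p ω - c) μ := fun p => (hG p).sub (integrable_const c)
  rw [integral_finsetSum _ (fun p _ => i1 p), integral_finsetSum _ (fun p _ => i2 p)]
  simp_rw [integral_sub (hHG _) (hH.const_mul c), integral_sub (hG _) (integrable_const c), integral_const_mul,
    integral_const, probReal_univ, one_smul]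
  rw [Finset.mul_sum, ← Finset.sum_sub_distrib]
  exact Finset.sum_congr rfl fun p _ => by ring

/-- **The six plaquettes of the one-site torus `(ℤ/1)⁴`.** [folklore] -/
theorem sum_plaquette_oneSite (f : Plaquette 4 1 → ℝ) :
    ∑ p, f p = f ((0 : Site 4 1), ⟨((0 : Fin 4), (1 : Fin 4)), by decide⟩) + f (0, ⟨(0, 2), by decide⟩) +
      f (0, ⟨(0, 3), by decide⟩) + f (0, ⟨(1, 2), by decide⟩) + f (0, ⟨(1, 3), by decide⟩) + f (0, ⟨(2, 3), by decide⟩) := by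
  rw [Fintype.sum_prod_type, Fintype.sum_unique]
  have hx : (default : Site 4 1) = 0 := Subsingleton.elim _ _
  rw [hx]
  have huniv : (Finset.univ : Finset {q : Fin 4 × Fin 4 // q.1 < q.2}) =
      {⟨(0, 1), by decide⟩, ⟨(0, 2), by decide⟩, ⟨(0, 3), by decide⟩, ⟨(1, 2), by decide⟩, ⟨(1, 3), by decide⟩,
        ⟨(2, 3), by decide⟩} := by decide
  rw [huniv]
  repeat rw [Finset.sum_insert (by decide)]
  rw [Finset.sum_singleton]
  ring

section Value

variable {n : ℕ}

/-- Local shorthand: `SU(2+n)`. -/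
local notation3 (prettyPrint := false) "SUn" => Matrix.specialUnitaryGroup (Fin (2 + n)) ℂ

/-- Local shorthand: the commutator energy `R(X,Y) = Re tr(X Y X⁻¹ Y⁻¹)`. -/
local notation3 (prettyPrint := false) "R" X:max Y:max =>
  (((X * Y * X⁻¹ * Y⁻¹ : SUn) : Matrix (Fin (2 + n)) (Fin (2 + n)) ℂ).trace.re : ℝ)

/-- Local shorthand: `w(X) = |tr X|²`. -/
local notation3 (prettyPrint := false) "w" X:max =>
  (Complex.normSq (Matrix.trace ((X : SUn) : Matrix (Fin (2 + n)) (Fin (2 + n)) ℂ)) : ℝ)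

/-- Local shorthand: Haar probability on `SU(2+n)`. -/
local notation3 (prettyPrint := false) "dH" => haarProbability (Matrix.specialUnitaryGroup (Fin (2 + n)) ℂ)

/-- Local shorthand: product Haar measure on the links of the one-site torus. -/
local notation3 (prettyPrint := false) "πE" =>
  Measure.pi (fun _ : Edge 4 1 => haarProbability (Matrix.specialUnitaryGroup (Fin (2 + n)) ℂ))

/-- Local shorthand: the link `(0, k)` of the one-site torus. -/
local notation3 (prettyPrint := false) "𝔢" k:max => (((0 : Site 4 1), (k : Fin 4)) : Edge 4 1)

/-- Distinctness of the four links. -/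
theorem edge_ne {i j : Fin 4} (h : i ≠ j) : (𝔢 i) ≠ (𝔢 j) := fun h' => h (congrArg Prod.snd h')

/-- Integrability of continuous observables of the one-site links. [folklore] -/
theorem integrable_links {f : GaugeConfig 4 1 SUn → ℝ} (hf : Continuous f) : Integrable f πE :=
  hf.integrable_of_hasCompactSupport (HasCompactSupport.of_compactSpace _)

/-- Continuity of a plaquette energy `U ↦ R(U_a, U_b)`. [folklore] -/
theorem continuous_linkR (a b : Edge 4 1) : Continuous fun U : GaugeConfig 4 1 SUn => R (U a) (U b) :=
  continuous_R_comp (continuous_apply a) (continuous_apply b)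

/-- ★★ **The first `β`-cumulant of the one-site complementary-plane covariance, evaluated**: with `P = R(U₀,U₁)`, `Q = R(U₂,U₃)`
and the tilt `X = −Σ_p (N − R(U_{p₁}, U_{p₂}))` over the six one-site plaquettes,
`Cov(PQ,X) − Cov(P,X)·E Q − E P·Cov(Q,X) = (4/N²)·κ_N`. [folklore] -/
theorem cumulant_value :
    ((∫ U, R (U (𝔢 0)) (U (𝔢 1)) * R (U (𝔢 2)) (U (𝔢 3)) *
        (-(∑ p : Plaquette 4 1, (((2 + n : ℕ) : ℝ) - R (U (p.1, p.2.1.1)) (U (p.1, p.2.1.2))))) ∂πE) -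
      (∫ U, R (U (𝔢 0)) (U (𝔢 1)) * R (U (𝔢 2)) (U (𝔢 3)) ∂πE) *
        (∫ U, (-(∑ p : Plaquette 4 1, (((2 + n : ℕ) : ℝ) - R (U (p.1, p.2.1.1)) (U (p.1, p.2.1.2))))) ∂πE)) -
    (((∫ U, R (U (𝔢 0)) (U (𝔢 1)) *
        (-(∑ p : Plaquette 4 1, (((2 + n : ℕ) : ℝ) - R (U (p.1, p.2.1.1)) (U (p.1, p.2.1.2))))) ∂πE) -
      (∫ U, R (U (𝔢 0)) (U (𝔢 1)) ∂πE) *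
        (∫ U, (-(∑ p : Plaquette 4 1, (((2 + n : ℕ) : ℝ) - R (U (p.1, p.2.1.1)) (U (p.1, p.2.1.2))))) ∂πE)) *
      (∫ U, R (U (𝔢 2)) (U (𝔢 3)) ∂πE) +
    (∫ U, R (U (𝔢 0)) (U (𝔢 1)) ∂πE) *
      ((∫ U, R (U (𝔢 2)) (U (𝔢 3)) *
        (-(∑ p : Plaquette 4 1, (((2 + n : ℕ) : ℝ) - R (U (p.1, p.2.1.1)) (U (p.1, p.2.1.2))))) ∂πE) -
      (∫ U, R (U (𝔢 2)) (U (𝔢 3)) ∂πE) *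
        (∫ U, (-(∑ p : Plaquette 4 1, (((2 + n : ℕ) : ℝ) - R (U (p.1, p.2.1.1)) (U (p.1, p.2.1.2))))) ∂πE))) =
    4 / ((2 + n : ℕ) : ℝ) ^ 2 * ∫ X, ∫ Y, (w X - 1) * (w Y - 1) * R X Y ∂dH ∂dH := by
  haveI := secondCountableTopology_su' (n := n)
  -- integrability of all the products of link energies
  have hcR := continuous_linkR (n := n)
  have iG : ∀ p : Plaquette 4 1, Integrable (fun U : GaugeConfig 4 1 SUn => R (U (p.1, p.2.1.1)) (U (p.1, p.2.1.2))) πE :=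
    fun p => integrable_links (hcR _ _)
  have iP : Integrable (fun U : GaugeConfig 4 1 SUn => R (U (𝔢 0)) (U (𝔢 1))) πE := integrable_links (hcR _ _)
  have iQ : Integrable (fun U : GaugeConfig 4 1 SUn => R (U (𝔢 2)) (U (𝔢 3))) πE := integrable_links (hcR _ _)
  have iPQ : Integrable (fun U : GaugeConfig 4 1 SUn => R (U (𝔢 0)) (U (𝔢 1)) * R (U (𝔢 2)) (U (𝔢 3))) πE :=
    integrable_links ((hcR _ _).mul (hcR _ _))
  have iPQG : ∀ p : Plaquette 4 1, Integrable (fun U : GaugeConfig 4 1 SUn =>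
      R (U (𝔢 0)) (U (𝔢 1)) * R (U (𝔢 2)) (U (𝔢 3)) * R (U (p.1, p.2.1.1)) (U (p.1, p.2.1.2))) πE :=
    fun p => integrable_links (((hcR _ _).mul (hcR _ _)).mul (hcR _ _))
  have iPG : ∀ p : Plaquette 4 1, Integrable (fun U : GaugeConfig 4 1 SUn =>
      R (U (𝔢 0)) (U (𝔢 1)) * R (U (p.1, p.2.1.1)) (U (p.1, p.2.1.2))) πE :=
    fun p => integrable_links ((hcR _ _).mul (hcR _ _))
  have iQG : ∀ p : Plaquette 4 1, Integrable (fun U : GaugeConfig 4 1 SUn =>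
      R (U (𝔢 2)) (U (𝔢 3)) * R (U (p.1, p.2.1.1)) (U (p.1, p.2.1.2))) πE :=
    fun p => integrable_links ((hcR _ _).mul (hcR _ _))
  rw [cov_neg_sum_const_sub _ _ _ iPQ iG iPQG, cov_neg_sum_const_sub _ _ _ iP iG iPG, cov_neg_sum_const_sub _ _ _ iQ iG iQG]
  rw [Finset.sum_mul, Finset.mul_sum, ← Finset.sum_add_distrib, ← Finset.sum_sub_distrib]
  rw [sum_plaquette_oneSite]
  dsimp only
  -- reader facts
  have hAR : ∀ x : SUn, ∫ x', (fun X Y : SUn => R X Y) x x' ∂dH = w x / (2 + n : ℝ) := fun x => integral_R_right x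
  have hAT : ∀ x : SUn, ∫ x', (fun X Y : SUn => R Y X) x x' ∂dH = w x / (2 + n : ℝ) := fun x => integral_R_left x
  have hcA := continuous_uncurry_R (n := n)
  have hcT := continuous_uncurry_Rt (n := n)
  have h01 : (𝔢 0) ≠ (𝔢 1) := edge_ne (by decide)
  have h02 : (𝔢 0) ≠ (𝔢 2) := edge_ne (by decide)
  have h03 : (𝔢 0) ≠ (𝔢 3) := edge_ne (by decide)
  have h12 : (𝔢 1) ≠ (𝔢 2) := edge_ne (by decide)
  have h13 : (𝔢 1) ≠ (𝔢 3) := edge_ne (by decide)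
  have h23 : (𝔢 2) ≠ (𝔢 3) := edge_ne (by decide)
  -- the shared expectations
  have eP : ∫ U, R (U (𝔢 0)) (U (𝔢 1)) ∂πE = 1 / (2 + n : ℝ) := by
    have h := integral_link_P (ι := Edge 4 1) hcA hAR h01; simpa only using h
  have eQ : ∫ U, R (U (𝔢 2)) (U (𝔢 3)) ∂πE = 1 / (2 + n : ℝ) := by
    have h := integral_link_P (ι := Edge 4 1) hcA hAR h23; simpa only using h
  have ePQ : ∫ U, R (U (𝔢 0)) (U (𝔢 1)) * R (U (𝔢 2)) (U (𝔢 3)) ∂πE = (1 / (2 + n : ℝ)) ^ 2 := by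
    have h := integral_link_PQ (ι := Edge 4 1) hcA hcA hAR hAR h01 h23 h02 h03 h12 h13; simpa only using h
  have eQP : ∫ U, R (U (𝔢 2)) (U (𝔢 3)) * R (U (𝔢 0)) (U (𝔢 1)) ∂πE = (1 / (2 + n : ℝ)) ^ 2 := by
    rw [← ePQ]; exact integral_congr_ae (ae_of_all _ fun U => mul_comm _ _)
  -- plane (0,1)
  have a1 : ∫ U, R (U (𝔢 0)) (U (𝔢 1)) * R (U (𝔢 2)) (U (𝔢 3)) * R (U (𝔢 0)) (U (𝔢 1)) ∂πE =
      (1 / (2 + n : ℝ)) * ∫ x, ∫ x', R x x' * R x x' ∂dH ∂dH := by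
    have h := integral_link_PQP (ι := Edge 4 1) hcA hcA hAR h01 h23 h02 h03 h12 h13; simpa only using h
  have a2 : ∫ U, R (U (𝔢 0)) (U (𝔢 1)) * R (U (𝔢 0)) (U (𝔢 1)) ∂πE = ∫ x, ∫ x', R x x' * R x x' ∂dH ∂dH := by
    have h := integral_link_PP (ι := Edge 4 1) hcA h01; simpa only using h
  -- plane (2,3)
  have b1 : ∫ U, R (U (𝔢 0)) (U (𝔢 1)) * R (U (𝔢 2)) (U (𝔢 3)) * R (U (𝔢 2)) (U (𝔢 3)) ∂πE =
      (1 / (2 + n : ℝ)) * ∫ y, ∫ y', R y y' * R y y' ∂dH ∂dH := by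
    have h := integral_link_PQQ (ι := Edge 4 1) hcA hcA hAR h01 h23 h02 h03 h12 h13; simpa only using h
  have b2 : ∫ U, R (U (𝔢 2)) (U (𝔢 3)) * R (U (𝔢 2)) (U (𝔢 3)) ∂πE = ∫ y, ∫ y', R y y' * R y y' ∂dH ∂dH := by
    have h := integral_link_PP (ι := Edge 4 1) hcA h23; simpa only using h
  -- plane (0,2): links (a,b,c,d) = (0,1,2,3), readers (R, R)
  have c1 : ∫ U, R (U (𝔢 0)) (U (𝔢 1)) * R (U (𝔢 2)) (U (𝔢 3)) * R (U (𝔢 0)) (U (𝔢 2)) ∂πE =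
      (1 / (2 + n : ℝ)) ^ 2 * ∫ x, ∫ y, w x * w y * R x y ∂dH ∂dH := by
    have h := integral_link_PQR (ι := Edge 4 1) hcA hcA hAR hAR h01 h23 h02 h03 h12 h13; simpa only using h
  have c2 : ∫ U, R (U (𝔢 0)) (U (𝔢 1)) * R (U (𝔢 0)) (U (𝔢 2)) ∂πE = (1 / (2 + n : ℝ)) * ∫ x, ∫ y, w x * R x y ∂dH ∂dH := by
    have h := integral_link_PR (ι := Edge 4 1) hcA hAR h01 h23 h02 h03 h12 h13; simpa only using h
  have c3 : ∫ U, R (U (𝔢 2)) (U (𝔢 3)) * R (U (𝔢 0)) (U (𝔢 2)) ∂πE = (1 / (2 + n : ℝ)) * ∫ x, ∫ y, w y * R x y ∂dH ∂dH := by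
    have h := integral_link_QR (ι := Edge 4 1) hcA hAR h01 h23 h02 h03 h12 h13; simpa only using h
  have c4 : ∫ U, R (U (𝔢 0)) (U (𝔢 2)) ∂πE = ∫ x, ∫ y, R x y ∂dH ∂dH := integral_link_R (ι := Edge 4 1) h02
  -- plane (0,3): links (0,1,3,2), readers (R, Rᵀ)
  have d1 : ∫ U, R (U (𝔢 0)) (U (𝔢 1)) * R (U (𝔢 2)) (U (𝔢 3)) * R (U (𝔢 0)) (U (𝔢 3)) ∂πE =
      (1 / (2 + n : ℝ)) ^ 2 * ∫ x, ∫ y, w x * w y * R x y ∂dH ∂dH := by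
    have h := integral_link_PQR (ι := Edge 4 1) hcA hcT hAR hAT h01 h23.symm h03 h02 h13 h12; simpa only using h
  have d2 : ∫ U, R (U (𝔢 0)) (U (𝔢 1)) * R (U (𝔢 0)) (U (𝔢 3)) ∂πE = (1 / (2 + n : ℝ)) * ∫ x, ∫ y, w x * R x y ∂dH ∂dH := by
    have h := integral_link_PR (ι := Edge 4 1) hcA hAR h01 h23.symm h03 h02 h13 h12; simpa only using h
  have d3 : ∫ U, R (U (𝔢 2)) (U (𝔢 3)) * R (U (𝔢 0)) (U (𝔢 3)) ∂πE = (1 / (2 + n : ℝ)) * ∫ x, ∫ y, w y * R x y ∂dH ∂dH := by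
    have h := integral_link_QR (ι := Edge 4 1) (B := fun X Y : SUn => R Y X) hcT hAT h01 h23.symm h03 h02 h13 h12
    simpa only using h
  have d4 : ∫ U, R (U (𝔢 0)) (U (𝔢 3)) ∂πE = ∫ x, ∫ y, R x y ∂dH ∂dH := integral_link_R (ι := Edge 4 1) h03
  -- plane (1,2): links (1,0,2,3), readers (Rᵀ, R)
  have f1 : ∫ U, R (U (𝔢 0)) (U (𝔢 1)) * R (U (𝔢 2)) (U (𝔢 3)) * R (U (𝔢 1)) (U (𝔢 2)) ∂πE =
      (1 / (2 + n : ℝ)) ^ 2 * ∫ x, ∫ y, w x * w y * R x y ∂dH ∂dH := by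
    have h := integral_link_PQR (ι := Edge 4 1) (A := fun X Y : SUn => R Y X) hcT hcA hAT hAR h01.symm h23 h12 h13 h02
      h03
    simpa only using h
  have f2 : ∫ U, R (U (𝔢 0)) (U (𝔢 1)) * R (U (𝔢 1)) (U (𝔢 2)) ∂πE = (1 / (2 + n : ℝ)) * ∫ x, ∫ y, w x * R x y ∂dH ∂dH := by
    have h := integral_link_PR (ι := Edge 4 1) (A := fun X Y : SUn => R Y X) hcT hAT h01.symm h23 h12 h13 h02 h03
    simpa only using h
  have f3 : ∫ U, R (U (𝔢 2)) (U (𝔢 3)) * R (U (𝔢 1)) (U (𝔢 2)) ∂πE = (1 / (2 + n : ℝ)) * ∫ x, ∫ y, w y * R x y ∂dH ∂dH := by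
    have h := integral_link_QR (ι := Edge 4 1) hcA hAR h01.symm h23 h12 h13 h02 h03; simpa only using h
  have f4 : ∫ U, R (U (𝔢 1)) (U (𝔢 2)) ∂πE = ∫ x, ∫ y, R x y ∂dH ∂dH := integral_link_R (ι := Edge 4 1) h12
  -- plane (1,3): links (1,0,3,2), readers (Rᵀ, Rᵀ)
  have g1 : ∫ U, R (U (𝔢 0)) (U (𝔢 1)) * R (U (𝔢 2)) (U (𝔢 3)) * R (U (𝔢 1)) (U (𝔢 3)) ∂πE =
      (1 / (2 + n : ℝ)) ^ 2 * ∫ x, ∫ y, w x * w y * R x y ∂dH ∂dH := by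
    have h := integral_link_PQR (ι := Edge 4 1) (A := fun X Y : SUn => R Y X) (B := fun X Y : SUn => R Y X) hcT hcT hAT
      hAT h01.symm h23.symm h13 h12 h03 h02
    simpa only using h
  have g2 : ∫ U, R (U (𝔢 0)) (U (𝔢 1)) * R (U (𝔢 1)) (U (𝔢 3)) ∂πE = (1 / (2 + n : ℝ)) * ∫ x, ∫ y, w x * R x y ∂dH ∂dH := by
    have h := integral_link_PR (ι := Edge 4 1) (A := fun X Y : SUn => R Y X) hcT hAT h01.symm h23.symm h13 h12 h03 h02
    simpa only using h
  have g3 : ∫ U, R (U (𝔢 2)) (U (𝔢 3)) * R (U (𝔢 1)) (U (𝔢 3)) ∂πE = (1 / (2 + n : ℝ)) * ∫ x, ∫ y, w y * R x y ∂dH ∂dH := by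
    have h := integral_link_QR (ι := Edge 4 1) (B := fun X Y : SUn => R Y X) hcT hAT h01.symm h23.symm h13 h12 h03 h02
    simpa only using h
  have g4 : ∫ U, R (U (𝔢 1)) (U (𝔢 3)) ∂πE = ∫ x, ∫ y, R x y ∂dH ∂dH := integral_link_R (ι := Edge 4 1) h13
  simp only [a1, a2, eQP, b1, b2, c1, c2, c3, c4, d1, d2, d3, d4, f1, f2, f3, f4, g1, g2, g3, g4, eP, eQ, ePQ, kappa_expand]
  have hN : (2 + (n : ℝ)) ≠ 0 := by positivity
  push_cast
  field_simp
  ring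

/-- ★★ **The one-site complementary-plane covariance of `SU(2+n)` is differentiable at `β = 0` with derivative `(4/N²)·κ_N`.**
[folklore] -/
theorem hasDerivAt_complementaryPlaneCov_oneSite :
    HasDerivAt (fun β : ℝ => complementaryPlaneCov (2 + n) 1 β)
      (4 / ((2 + n : ℕ) : ℝ) ^ 2 * ∫ X, ∫ Y, (w X - 1) * (w Y - 1) * R X Y ∂dH ∂dH) 0 := by
  haveI : SecondCountableTopology SUn := secondCountableTopology_su' (n := n)
  have hρc : Continuous (fundamentalRep (Fin (2 + n))) := continuous_fundamentalRep (Fin (2 + n))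
  -- the three observables, as opaque functions with defining equations
  obtain ⟨Pf, hPf⟩ : ∃ Pf : GaugeConfig 4 1 SUn → ℝ, Pf = fun U => R (U (𝔢 0)) (U (𝔢 1)) := ⟨_, rfl⟩
  obtain ⟨Qf, hQf⟩ : ∃ Qf : GaugeConfig 4 1 SUn → ℝ, Qf = fun U => R (U (𝔢 2)) (U (𝔢 3)) := ⟨_, rfl⟩
  obtain ⟨Xf, hXf⟩ : ∃ Xf : GaugeConfig 4 1 SUn → ℝ,
      Xf = fun U => -(∑ p : Plaquette 4 1, (((2 + n : ℕ) : ℝ) - R (U (p.1, p.2.1.1)) (U (p.1, p.2.1.2)))) := ⟨_, rfl⟩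
  have hP : suPlaquetteReTrace (2 + n) 1 (originPlaquette 1 0 1 (by decide)) = Pf := by
    rw [hPf]; funext U; rw [suPlaquetteReTrace_apply]; simp only [originPlaquette]; rw [plaquetteHolonomy_oneSite]
  have hQ : suPlaquetteReTrace (2 + n) 1 (originPlaquette 1 2 3 (by decide)) = Qf := by
    rw [hQf]; funext U; rw [suPlaquetteReTrace_apply]; simp only [originPlaquette]; rw [plaquetteHolonomy_oneSite]
  have hXw : ∀ U : GaugeConfig 4 1 SUn, -wilsonAction (fundamentalRep (Fin (2 + n))) U = Xf U := by
    intro U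
    rw [hXf]
    unfold wilsonAction
    simp only [fundamentalRep_apply, plaquetteHolonomy_oneSite]
  have hXfun : (fun U : GaugeConfig 4 1 SUn => -wilsonAction (fundamentalRep (Fin (2 + n))) U) = Xf := funext hXw
  -- the Wilson measure of the one-site torus is product Haar tilted by `β · Xf`
  have hμ : ∀ β : ℝ, suWilsonMeasure (2 + n) 1 β = (πE).tilted (fun U => β * Xf U) := by
    intro β
    unfold suWilsonMeasure
    rw [wilsonMeasure_eq_tilted_pi _ hρc β]
    congr 1
    funext U
    rw [← hXw U]
    ring
  -- bounds and measurability
  obtain ⟨BP, -, hBP⟩ := exists_bound_trace_re_nonneg (fundamentalRep (Fin (2 + n))) hρc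
  obtain ⟨BX, hBX⟩ := exists_abs_wilsonAction_le (d := 4) (L := 1) (fundamentalRep (Fin (2 + n))) hρc
  have hXm : Measurable Xf := by
    rw [← hXfun]; exact (measurable_wilsonAction _ hρc).neg
  have hXb : ∀ U, |Xf U| ≤ BX := fun U => by rw [← hXw U, abs_neg]; exact hBX U
  have hPm : Measurable Pf := by rw [hPf]; exact (continuous_linkR _ _).measurable
  have hQm : Measurable Qf := by rw [hQf]; exact (continuous_linkR _ _).measurable
  have hBP' : ∀ g : SUn, |((g : Matrix (Fin (2 + n)) (Fin (2 + n)) ℂ).trace).re| ≤ BP := fun g => by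
    simpa only [fundamentalRep_apply] using hBP g
  have hPb : ∀ U, |Pf U| ≤ BP := fun U => by rw [hPf]; exact hBP' _
  have hQb : ∀ U, |Qf U| ≤ BP := fun U => by rw [hQf]; exact hBP' _
  have hPQm : Measurable (fun U => Pf U * Qf U) := hPm.mul hQm
  have hPQb : ∀ U, |(fun U => Pf U * Qf U) U| ≤ BP * BP := fun U => by
    simp only [abs_mul]
    exact mul_le_mul (hPb U) (hQb U) (abs_nonneg _) ((abs_nonneg _).trans (hPb U))
  -- the first cumulants of the three tilted means
  have hA := hasDerivAt_integral_tilted_zero (μ := πE) hXm hPQm hXb hPQb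
  have hB := hasDerivAt_integral_tilted_zero (μ := πE) hXm hPm hXb hPb
  have hC := hasDerivAt_integral_tilted_zero (μ := πE) hXm hQm hXb hQb
  have hD := hA.sub (hB.mul hC)
  have h0 : (πE).tilted (fun U => (0 : ℝ) * Xf U) = πE := by simp
  simp only [h0] at hD
  -- the covariance as a function of `β`
  have hfun : (fun β : ℝ => complementaryPlaneCov (2 + n) 1 β) = fun β =>
      (∫ U, Pf U * Qf U ∂(πE).tilted (fun U => β * Xf U)) -
        (∫ U, Pf U ∂(πE).tilted (fun U => β * Xf U)) * (∫ U, Qf U ∂(πE).tilted (fun U => β * Xf U)) := by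
    funext β
    unfold complementaryPlaneCov
    rw [covariance_suPlaquetteReTrace_eq, hμ β, hP, hQ]
  rw [hfun]
  refine hD.congr_deriv ?_
  subst hPf hQf hXf
  beta_reduce
  exact cumulant_value

end Value

/-- ★★ **Crux `OneSiteCovDerivative` of route `ToronCumulantSign`** (stmt-QuantumFields-27531): for every `N ≥ 2` the one-site
complementary-plane covariance is differentiable at `β = 0` with derivative `(4/N²)·κ_N`. -/
theorem oneSiteCovDerivative_proof : Summit.QuantumFields.YangMills.Theses.ToronCumulantSign.OneSiteCovDerivative := by
  intro N hN
  obtain ⟨n, rfl⟩ := Nat.exists_eq_add_of_le hN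
  exact hasDerivAt_complementaryPlaneCov_oneSite (n := n)

end Summit.QuantumFields.YangMills.Theorems.ToronCumulantSign
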